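import Literature.Geometry.Kaehler.ComplexTorusHodgeGroupHodgeCircleProductsSplit
import Literature.Geometry.Kaehler.ComplexTorusMumfordTateGroupHodgeCircle
import Literature.Geometry.Kaehler.ComplexTorusMumfordTateGroupProductEllipticCurves
import HarnessLib

/-!
# The Mumford–Tate group of a product of two tori on the Hodge-circle locus: `MT(X₁ × X₂)(ℝ) = h(ℂ^×)` (the
# Deligne torus, diagonal) iff `Hom(X₁, X₂) ≠ 0`, and on the SPLIT branch `Hom(X₁, X₂) = 0`
# `MT(X₁ × X₂)(ℝ) = {(h₁(z₁) 0; 0 h₂(z₂)) : |z₁| = |z₂| ≠ 0} = MT(X₁)(ℝ) ×_{𝔾_m} MT(X₂)(ℝ)`, commutative, of CM type;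
# `(1, −1) ∈ MT(X₁ × X₂)` ⟺ `Hom(X₁, X₂) = 0`
# (Moonen 1999 (1.11)–(1.13), Moonen 2004 Lemma 4.6 / (5.2) / Exercise (5.6), Lombardo 2019 §2.2, CMSP 2017 15.2.3–15.2.4,
# Imai 1976, Gordon 1997 §2)

Layer `Literature/Geometry/Kaehler`, namespace `Literature.Geometry.Kaehler.ComplexTorus`; lane `lit-hodgefound` (Track 2
foundations library, Layer A1/A3 «Mumford–Tate groups of complex tori; CM type; products»), prover seat p17, generation 33,
self-proposed row g33-#3 = the gen-32 pointer (ο) «`MT(X₁ × X₂)(ℝ)` on the split branch».  Sequel BY NAME of g32-#4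
(`ComplexTorusHodgeGroupHodgeCircleProductsSplit`: `Hg(X₁ × X₂)(ℝ) = Hg(X₁)(ℝ) × Hg(X₂)(ℝ)` iff `Hom = 0` for two tori on the
locus — `hodgeGroup_prodPeriod_eq_map_blockDiag_of_coe_eq_range_of_homRat_eq_bot`), of g32-#1 (`ComplexTorusHodgeGroupHodgeCircleProducts`:
`coe_hodgeGroup_prodPeriod_eq_range_iff_homRat_ne_bot`), of g32-#2 (`ComplexTorusMumfordTateGroupHodgeCircle`:
`MT(X)(ℝ) = h(ℂ^×)` ⟺ `Hg(X)(ℝ) = h(S¹)`, `coe_mumfordTateGroup_eq_range_hodgeSGL_of_coe_hodgeGroup_eq_range`,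
`mem_range_hodgeSGL_iff`, `hodgeS_injective`, `mumfordTateGroup_comm_of_coe_hodgeGroup_eq_range`), of
`ComplexTorusMumfordTateGroupProduct` (Moonen's Lemma 4.6 on real points: `exists_eq_blockDiagGL_of_mem_mumfordTateGroup_prod`,
the multiplier relation `det_pow_eq_of_blockDiagGL_mem_mumfordTateGroup_prod`, `hodgeS_prodPeriod`, `blockDiagGL`,
`toGL_blockDiag`, `mumfordTateGroup_prod_lt`), of `ComplexTorusMumfordTateGroupProductEllipticCurves` (the strictness witness
`blockDiagGL_one_neg_one_not_mem_mumfordTateGroup_prod` for `Hom ≠ 0`) and of `ComplexTorusMumfordTateGroup` (`hodgeS`,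
`det_hodgeS`, `hodgeS_eq_norm_smul_hodgeCircle`, `hodgeS_mul`, `scalar_mul_toGL_mem_mumfordTateGroup`).  THEOREMS ONLY: no
definition, no instance, no named fact, nothing conditional (D-0026, net debt 0).

## Sources, verbatim

* B. Moonen, *Notes on Mumford–Tate groups* (1999), (1.13) Remark: «`Hg(V) ⊆ Hg(V₁) × Hg(V₂)`. This need not be an
  equality … For the Mumford-Tate group similar statements hold, but note that `MT(V)` is almost never equal to
  `MT(V₁) × MT(V₂)`, as the central factor `𝔾_m = 𝔾_m · id` is counted twice in `MT(V₁) × MT(V₂)`»; (1.11): «`MT(V)` is the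
  almost direct product (inside `GL(V)`) of `𝔾_{m,ℚ}` and `Hg(V)`».
* B. Moonen, *An introduction to Mumford–Tate groups* (2004), §4 Lemma 4.6: «If `V₁` and `V₂` are `ℚ`-HS then
  `MT(V₁ ⊕ V₂) ⊂ MT(V₁) × MT(V₂)` … and the projection maps `prᵢ : MT(V₁ ⊕ V₂) → MT(Vᵢ)` are surjective»; (5.2); §5
  (5.6) Exercise: «Consider a product `X = E₁ × E₂` of two elliptic curves … try to determine the Mumford-Tate group of `X`».
* D. Lombardo, *Computing the geometric endomorphism ring of a genus-2 Jacobian* (2019), §2.2 case 5: «the product of two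
  non-isogenous elliptic curves … The Mumford-Tate group has rank 3, and it is isomorphic to `𝔾_m · (M₁ × M₂)`, where …
  `M_i = {x ∈ Res_{F_i/ℚ}(𝔾_m) | x x̄ = 1}` if `F_i` is imaginary quadratic»; case 6: «the square of an elliptic curve … The
  Mumford-Tate group is `𝔾_m · {(x, x) | x ∈ M}`».
* J. Carlson, S. Müller-Stach, C. Peters, *Period Mappings and Period Domains* (2nd ed. 2017), §15.2 Problem 15.2.3 (a)
  («`MT(H₁ ⊕ H₂) ⊂ 𝔾_m · (SMT(H₁) × SMT(H₂))`»), Examples 15.2.4 (ii) («`MT(H¹(C))(ℚ) = Res_{K/ℚ} K^×`»).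
* H. Imai (1976), §2 Proposition and §3 Remarks (p. 370); B. B. Gordon (1997), §2.3 Lemma (iii) («`MT(V) = 𝔾_m · Hg(V)`»),
  §2.6 Lemma; M. Green, P. Griffiths, M. Kerr (2012), §I.B (i)–(ii), §III.B (i); A. Beauville (2014), §4 Lemma 1.

## What is proved (`X₁ = E₁/Φ₁(ℤ^{ι₁})`, `X₂ = E₂/Φ₂(ℤ^{ι₂})` complex tori of dimensions `g₁, g₂ ≥ 1` ON THE HODGE-CIRCLE LOCUS
`Hg(Xᵢ)(ℝ) = hᵢ(S¹)`; `h(z) = hodgeS`, `MT(X)(ℝ) = mumfordTateGroup ≤ GL_ι(ℝ)`, `(A 0; 0 B) = blockDiagGL (A, B)`)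

* §1 **BOTH FACTORS**: `MT(Xᵢ)(ℝ) = hᵢ(ℂ^×)`; hence EVERY `M ∈ MT(X₁ × X₂)(ℝ)` is `(h₁(z₁) 0; 0 h₂(z₂))` with `zᵢ ≠ 0` AND
  `|z₁| = |z₂|` (Lemma 4.6 + the multiplier relation `det₁^{2g₂} = det₂^{2g₁}`, `det hᵢ(z) = |z|^{2gᵢ}`) —
  `exists_eq_fromBlocks_hodgeS_of_mem_mumfordTateGroup_prodPeriod`; the real-points «`MT ⊂ 𝔾_m · (Hg × Hg)`»:
  `M = |z| · (h₁(e^{iθ₁}) 0; 0 h₂(e^{iθ₂}))`; hence **`MT(X₁ × X₂)(ℝ)` IS COMMUTATIVE for every pair on the locus** (CM type,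
  `mumfordTateGroup_prodPeriod_comm_of_coe_eq_range_of_coe_eq_range`).
* §2 **THE SPLIT BRANCH `Hom(X₁, X₂) = 0`: `M ∈ MT(X₁ × X₂)(ℝ)` ⟺ `M = (h₁(z₁) 0; 0 h₂(z₂))`, `z₁ ≠ 0`, `|z₁| = |z₂|`**
  (`mem_mumfordTateGroup_prodPeriod_iff_of_coe_eq_range_of_homRat_eq_bot`: `⟸` is `|z| · (h₁(e^{iθ₁}), h₂(e^{iθ₂}))` with
  `(h₁(e^{iθ₁}), h₂(e^{iθ₂})) ∈ Hg(X₁) × Hg(X₂) = Hg(X₁ × X₂)` by g32-#4 — Lombardo's `𝔾_m · (M₁ × M₂)`, `Mᵢ = U(1)`, rank 3);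
  the FIBRE PRODUCT over the multiplier **`(A 0; 0 B) ∈ MT(X₁ × X₂) ⟺ A ∈ MT(X₁) ∧ B ∈ MT(X₂) ∧ det(A)^{2g₂} = det(B)^{2g₁}`**
  (`blockDiagGL_mem_mumfordTateGroup_prodPeriod_iff_…`); `(1 0; 0 −1) ∈ MT(X₁ × X₂)(ℝ)`;
  `MT(X₁ × X₂)(ℝ) ∩ SL = Hg(X₁ × X₂)(ℝ)` exactly.
* §3 **THE DICHOTOMY**: `MT(X₁ × X₂)(ℝ) = h(ℂ^×)` ⟺ `Hom(X₁, X₂) ≠ 0` (`coe_mumfordTateGroup_prodPeriod_eq_range_hodgeSGL_iff_homRat_ne_bot`,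
  then `M = (h₁(z) 0; 0 h₂(z))`, ONE `z` — Lombardo's `𝔾_m · {(x, x)}`); **`(1 0; 0 −1) ∈ MT(X₁ × X₂)(ℝ)` ⟺ `Hom(X₁, X₂) = 0`**
  (`blockDiagGL_one_neg_one_mem_mumfordTateGroup_prodPeriod_iff_homRat_eq_bot`); on both branches
  `MT(X₁ × X₂)(ℝ) ⊊ MT(X₁)(ℝ) × MT(X₂)(ℝ)` («almost never equal», the tree's `mumfordTateGroup_prod_lt`, recalled); the split
  branch is NOT the Deligne torus (`coe_mumfordTateGroup_prodPeriod_ne_range_hodgeSGL_of_homRat_eq_bot`).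
* §4 **TWO CM ELLIPTIC CURVES `E_i × E_{i√2}`**: `MT(ℝ) = {(h₁(z₁) 0; 0 h₂(z₂)) : |z₁| = |z₂| ≠ 0}` = `T_{K₁} ×_{Nm} T_{K₂}` on
  real points (Exercise (5.6), the CM × CM non-isogenous case).

## References

* [Moonen1999MTNotes] B. Moonen, *Notes on Mumford–Tate groups* (1999), (1.11), (1.13). [cite: Moonen1999MTNotes, (1.11) and (1.13) Remark]
* [Moonen2004MT] B. Moonen, *An introduction to Mumford–Tate groups* (2004), §4 Lemma 4.6, §5 (5.2), (5.6) Exercise.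
  [cite: Moonen2004MT, §4 Lemma 4.6, §5 (5.2) and (5.6) Exercise with Hint (p. 12)]
* [Lombardo2019] D. Lombardo, *Computing the geometric endomorphism ring of a genus-2 Jacobian*, Math. Comp. 88 (2019),
  §2.2 cases 5, 6. [cite: Lombardo2019, §2.2 cases 5 and 6 (arXiv:1610.09674 p. 4)]
* [CarlsonMullerStachPeters2017] J. Carlson, S. Müller-Stach, C. Peters (2017), §15.2 Problem 15.2.3 (a), Examples 15.2.4 (ii).
  [cite: CarlsonMullerStachPeters2017, §15.2 Problem 15.2.3 (a) and Examples 15.2.4 (ii) (PDF p. 369)]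
* [Imai1976HodgeGroups] H. Imai (1976), §2 Proposition, §3 Remarks. [cite: Imai1976HodgeGroups, §2 Proposition (p. 368) and §3 Remarks (p. 370)]
* [Gordon1997] B. B. Gordon (1997), §2.3 Lemma (iii), §2.6 Lemma. [cite: Gordon1997, §2.3 Lemma (iii) and §2.6 Lemma]
* [GreenGriffithsKerr2012] M. Green, P. Griffiths, M. Kerr (2012), §I.B (i)–(ii), §III.B (i). [cite: GreenGriffithsKerr2012, §I.B (i)–(ii) and §III.B (i) (p. 72)]
* [Beauville2014MaximalPicard] A. Beauville (2014), §4 Lemma 1. [cite: Beauville2014MaximalPicard, §4 Lemma 1]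
-/

noncomputable section

open scoped Matrix Real

open Set Function Module Matrix

namespace Literature.Geometry.Kaehler

namespace ComplexTorus

variable {ι₁ ι₂ : Type*} [Fintype ι₁] [Fintype ι₂] [DecidableEq ι₁] [DecidableEq ι₂]
  {E₁ E₂ : Type*} [NormedAddCommGroup E₁] [NormedSpace ℂ E₁] [NormedAddCommGroup E₂] [NormedSpace ℂ E₂]
  [FiniteDimensional ℂ E₁] [FiniteDimensional ℂ E₂]
  (Φ₁ : (ι₁ → ℝ) ≃L[ℝ] E₁) (Φ₂ : (ι₂ → ℝ) ≃L[ℝ] E₂)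

/-! ## §0 Bookkeeping: non-empty index types, `h(z)` versus `|z| · h(e^{iθ})` -/

section Prelim

include Φ₁ in
omit [DecidableEq ι₁] in
/-- `g₁ ≥ 1` ⟹ the lattice index type is non-empty (`|ι₁| = 2g₁`). [cite: Lange2023AbelianVarietiesComplex, §1.1.1] -/
private theorem nonempty_index_of_finrank_pos (hg₁ : 0 < finrank ℂ E₁) : Nonempty ι₁ :=
  Fintype.card_pos_iff.1 (by rw [card_eq_two_mul_finrank Φ₁]; omega)

omit [FiniteDimensional ℂ E₁] [FiniteDimensional ℂ E₂] in
/-- `h(z) = |z| · h(e^{i arg z})` blockwise: `(h₁(z₁) 0; 0 h₂(z₂)) = r · (h₁(e^{iθ₁}) 0; 0 h₂(e^{iθ₂}))` when `|z₁| = |z₂| = r`.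
[cite: Lange2023AbelianVarietiesComplex, §7.1.1 Remark 7.1.2] [cite: Gordon1997, §2.3 Lemma (iii)] -/
private theorem fromBlocks_hodgeS_eq_smul_of_norm_eq {z₁ z₂ : ℂ} (h : ‖z₁‖ = ‖z₂‖) :
    Matrix.fromBlocks (hodgeS Φ₁ z₁) 0 0 (hodgeS Φ₂ z₂) =
      ‖z₁‖ • Matrix.fromBlocks (hodgeCircle Φ₁ (Complex.arg z₁)) 0 0 (hodgeCircle Φ₂ (Complex.arg z₂)) := by
  rw [hodgeS_eq_norm_smul_hodgeCircle, hodgeS_eq_norm_smul_hodgeCircle, ← h, Matrix.fromBlocks_smul, smul_zero, smul_zero]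

omit [FiniteDimensional ℂ E₁] [FiniteDimensional ℂ E₂] in
/-- The matrix of `r · ((A 0; 0 B))` in `GL`: `(r·1) * toGL (blockDiag (A, B)) = r • (A 0; 0 B)`. [folklore] -/
private theorem coe_scalar_mul_toGL_blockDiag (r : ℝˣ) (A : SpecialLinearGroup ι₁ ℝ) (B : SpecialLinearGroup ι₂ ℝ) :
    ((Matrix.GeneralLinearGroup.scalar (ι₁ ⊕ ι₂) r *
        (Matrix.SpecialLinearGroup.toGL (blockDiag ι₁ ι₂ (A, B)) : GL (ι₁ ⊕ ι₂) ℝ) : GL (ι₁ ⊕ ι₂) ℝ) :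
        Matrix (ι₁ ⊕ ι₂) (ι₁ ⊕ ι₂) ℝ) =
      (r : ℝ) • Matrix.fromBlocks (A : Matrix ι₁ ι₁ ℝ) 0 0 (B : Matrix ι₂ ι₂ ℝ) := by
  rw [Units.val_mul, Matrix.GeneralLinearGroup.coe_scalar, Matrix.scalar_apply, ← Matrix.smul_one_eq_diagonal,
    Matrix.smul_mul, Matrix.one_mul, Matrix.SpecialLinearGroup.coe_GL_coe_matrix, coe_blockDiag]

end Prelim

/-! ## §1 Both factors on the locus: every element of `MT(X₁ × X₂)(ℝ)` is `(h₁(z₁) 0; 0 h₂(z₂))` with `|z₁| = |z₂|` -/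

section BothFactors

/-- **LEMMA 4.6 + THE MULTIPLIER ON THE HODGE-CIRCLE LOCUS: every `M ∈ MT(X₁ × X₂)(ℝ)` is `(h₁(z₁) 0; 0 h₂(z₂))` with
`z₁, z₂ ≠ 0` AND `|z₁| = |z₂|`** — `M = (A 0; 0 B)` with `A ∈ MT(X₁)(ℝ) = h₁(ℂ^×)`, `B ∈ MT(X₂)(ℝ) = h₂(ℂ^×)` (both factors
on the locus, g32-#2) and `det(A)^{2g₂} = det(B)^{2g₁}`, i.e. `|z₁|^{4g₁g₂} = |z₂|^{4g₁g₂}` («the central factor `𝔾_m` is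
counted twice in `MT(V₁) × MT(V₂)`» — here it is the ONLY defect). [cite: Moonen2004MT, §4 Lemma 4.6 and §5 (5.2)]
[cite: Moonen1999MTNotes, (1.13) Remark] [cite: CarlsonMullerStachPeters2017, §15.2 Problem 15.2.3 (a) and Examples 15.2.4 (ii)] -/
theorem exists_eq_fromBlocks_hodgeS_of_mem_mumfordTateGroup_prodPeriod (hg₁ : 0 < finrank ℂ E₁) (hg₂ : 0 < finrank ℂ E₂)
    (h₁ : (hodgeGroup Φ₁ : Set (SpecialLinearGroup ι₁ ℝ)) = Set.range (hodgeCircleSL Φ₁))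
    (h₂ : (hodgeGroup Φ₂ : Set (SpecialLinearGroup ι₂ ℝ)) = Set.range (hodgeCircleSL Φ₂)) {M : GL (ι₁ ⊕ ι₂) ℝ}
    (hM : M ∈ mumfordTateGroup (prodPeriod Φ₁ Φ₂)) :
    ∃ z₁ z₂ : ℂ, z₁ ≠ 0 ∧ z₂ ≠ 0 ∧ ‖z₁‖ = ‖z₂‖ ∧
      (M : Matrix (ι₁ ⊕ ι₂) (ι₁ ⊕ ι₂) ℝ) = Matrix.fromBlocks (hodgeS Φ₁ z₁) 0 0 (hodgeS Φ₂ z₂) := by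
  haveI := nonempty_index_of_finrank_pos Φ₁ hg₁
  haveI := nonempty_index_of_finrank_pos Φ₂ hg₂
  obtain ⟨A, hA, B, hB, rfl⟩ := exists_eq_blockDiagGL_of_mem_mumfordTateGroup_prod Φ₁ Φ₂ hM
  have hA' : A ∈ (mumfordTateGroup Φ₁ : Set (GL ι₁ ℝ)) := hA
  have hB' : B ∈ (mumfordTateGroup Φ₂ : Set (GL ι₂ ℝ)) := hB
  rw [coe_mumfordTateGroup_eq_range_hodgeSGL_of_coe_hodgeGroup_eq_range Φ₁ h₁, mem_range_hodgeSGL_iff] at hA'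
  rw [coe_mumfordTateGroup_eq_range_hodgeSGL_of_coe_hodgeGroup_eq_range Φ₂ h₂, mem_range_hodgeSGL_iff] at hB'
  obtain ⟨z₁, hz₁, hAz⟩ := hA'
  obtain ⟨z₂, hz₂, hBz⟩ := hB'
  have hdet := det_pow_eq_of_blockDiagGL_mem_mumfordTateGroup_prod Φ₁ Φ₂ hM
  rw [hAz, hBz, det_hodgeS, det_hodgeS, ← pow_mul, ← pow_mul, mul_comm (Fintype.card ι₂)] at hdet
  have hnorm : ‖z₁‖ = ‖z₂‖ :=
    (pow_left_inj₀ (norm_nonneg z₁) (norm_nonneg z₂) (mul_ne_zero Fintype.card_ne_zero Fintype.card_ne_zero)).1 hdet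
  exact ⟨z₁, z₂, hz₁, hz₂, hnorm, by rw [coe_blockDiagGL, hAz, hBz]⟩

/-- … **in the form «`MT ⊂ 𝔾_m · (Hg(X₁) × Hg(X₂))`» on REAL points: `M = r · (h₁(e^{iθ₁}) 0; 0 h₂(e^{iθ₂}))`, `r > 0`**
(for tori on the locus the defect of CMSP's inclusion on real points — complex scalars — disappears).
[cite: CarlsonMullerStachPeters2017, §15.2 Problem 15.2.3 (a)] [cite: Gordon1997, §2.3 Lemma (iii)] -/
theorem exists_eq_smul_fromBlocks_hodgeCircle_of_mem_mumfordTateGroup_prodPeriod (hg₁ : 0 < finrank ℂ E₁)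
    (hg₂ : 0 < finrank ℂ E₂) (h₁ : (hodgeGroup Φ₁ : Set (SpecialLinearGroup ι₁ ℝ)) = Set.range (hodgeCircleSL Φ₁))
    (h₂ : (hodgeGroup Φ₂ : Set (SpecialLinearGroup ι₂ ℝ)) = Set.range (hodgeCircleSL Φ₂)) {M : GL (ι₁ ⊕ ι₂) ℝ}
    (hM : M ∈ mumfordTateGroup (prodPeriod Φ₁ Φ₂)) :
    ∃ r θ₁ θ₂ : ℝ, 0 < r ∧
      (M : Matrix (ι₁ ⊕ ι₂) (ι₁ ⊕ ι₂) ℝ) = r • Matrix.fromBlocks (hodgeCircle Φ₁ θ₁) 0 0 (hodgeCircle Φ₂ θ₂) := by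
  obtain ⟨z₁, z₂, hz₁, -, hnorm, hM'⟩ :=
    exists_eq_fromBlocks_hodgeS_of_mem_mumfordTateGroup_prodPeriod Φ₁ Φ₂ hg₁ hg₂ h₁ h₂ hM
  exact ⟨‖z₁‖, Complex.arg z₁, Complex.arg z₂, norm_pos_iff.2 hz₁,
    hM'.trans (fromBlocks_hodgeS_eq_smul_of_norm_eq Φ₁ Φ₂ hnorm)⟩

/-- **`MT(X₁ × X₂)(ℝ)` IS COMMUTATIVE FOR EVERY PAIR OF TORI ON THE HODGE-CIRCLE LOCUS** — both branches at once
(`(h₁(z₁) 0; 0 h₂(z₂))` and `(h₁(w₁) 0; 0 h₂(w₂))` commute, `h(z)h(w) = h(zw)`): `h(ℂ^×)` when `Hom ≠ 0`, the torus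
`𝔾_m · (U(1) × U(1))` when `Hom = 0`; `X₁ × X₂ ∼ E_{τ₁}^{g₁} × E_{τ₂}^{g₂}` is of CM type in the Mumford–Tate sense.
[cite: Gordon1997, §2.3 Lemma (iii) and Prop. 2.12] [cite: Lombardo2019, §2.2 cases 5 and 6] [cite: Lange2023AbelianVarietiesComplex, §7.2.3 Prop. 7.2.6] -/
theorem mumfordTateGroup_prodPeriod_comm_of_coe_eq_range_of_coe_eq_range (hg₁ : 0 < finrank ℂ E₁)
    (hg₂ : 0 < finrank ℂ E₂) (h₁ : (hodgeGroup Φ₁ : Set (SpecialLinearGroup ι₁ ℝ)) = Set.range (hodgeCircleSL Φ₁))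
    (h₂ : (hodgeGroup Φ₂ : Set (SpecialLinearGroup ι₂ ℝ)) = Set.range (hodgeCircleSL Φ₂)) {M N : GL (ι₁ ⊕ ι₂) ℝ}
    (hM : M ∈ mumfordTateGroup (prodPeriod Φ₁ Φ₂)) (hN : N ∈ mumfordTateGroup (prodPeriod Φ₁ Φ₂)) : M * N = N * M := by
  obtain ⟨z₁, z₂, -, -, -, hM'⟩ := exists_eq_fromBlocks_hodgeS_of_mem_mumfordTateGroup_prodPeriod Φ₁ Φ₂ hg₁ hg₂ h₁ h₂ hM
  obtain ⟨w₁, w₂, -, -, -, hN'⟩ := exists_eq_fromBlocks_hodgeS_of_mem_mumfordTateGroup_prodPeriod Φ₁ Φ₂ hg₁ hg₂ h₁ h₂ hN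
  refine Units.ext ?_
  rw [Units.val_mul, Units.val_mul, hM', hN', Matrix.fromBlocks_multiply, Matrix.fromBlocks_multiply]
  simp only [Matrix.mul_zero, Matrix.zero_mul, add_zero, zero_add, ← hodgeS_mul, mul_comm z₁, mul_comm z₂]

end BothFactors

/-! ## §2 The split branch `Hom(X₁, X₂) = 0`: `MT(X₁ × X₂)(ℝ) = {(h₁(z₁) 0; 0 h₂(z₂)) : |z₁| = |z₂| ≠ 0}` -/

section Split

/-- **ON THE SPLIT BRANCH EVERY `(h₁(z₁) 0; 0 h₂(z₂))` WITH `|z₁| = |z₂| ≠ 0` LIES IN `MT(X₁ × X₂)(ℝ)`**: it is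
`|z₁| · (h₁(e^{iθ₁}) 0; 0 h₂(e^{iθ₂}))` with the second factor in `Hg(X₁)(ℝ) × Hg(X₂)(ℝ) = Hg(X₁ × X₂)(ℝ)` (g32-#4) and
`ℝ^× · Hg ⊆ MT`. [cite: Moonen1999MTNotes, (1.11)] [cite: Gordon1997, §2.3 Lemma (iii)] [cite: Imai1976HodgeGroups, §2 Proposition (p. 368)] -/
theorem mem_mumfordTateGroup_prodPeriod_of_coe_eq_fromBlocks_hodgeS (hg₁ : 0 < finrank ℂ E₁) (hg₂ : 0 < finrank ℂ E₂)
    (h₁ : (hodgeGroup Φ₁ : Set (SpecialLinearGroup ι₁ ℝ)) = Set.range (hodgeCircleSL Φ₁))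
    (h₂ : (hodgeGroup Φ₂ : Set (SpecialLinearGroup ι₂ ℝ)) = Set.range (hodgeCircleSL Φ₂)) (h12 : homRat Φ₁ Φ₂ = ⊥)
    {M : GL (ι₁ ⊕ ι₂) ℝ} {z₁ z₂ : ℂ} (hz₁ : z₁ ≠ 0) (hnorm : ‖z₁‖ = ‖z₂‖)
    (hM : (M : Matrix (ι₁ ⊕ ι₂) (ι₁ ⊕ ι₂) ℝ) = Matrix.fromBlocks (hodgeS Φ₁ z₁) 0 0 (hodgeS Φ₂ z₂)) :
    M ∈ mumfordTateGroup (prodPeriod Φ₁ Φ₂) := by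
  have hNmem : blockDiag ι₁ ι₂ (hodgeCircleSL Φ₁ (Complex.arg z₁), hodgeCircleSL Φ₂ (Complex.arg z₂)) ∈
      hodgeGroup (prodPeriod Φ₁ Φ₂) := by
    rw [hodgeGroup_prodPeriod_eq_map_blockDiag_of_coe_eq_range_of_homRat_eq_bot Φ₁ Φ₂ hg₁ hg₂ h₁ h₂ h12]
    exact Subgroup.mem_map.2 ⟨(hodgeCircleSL Φ₁ (Complex.arg z₁), hodgeCircleSL Φ₂ (Complex.arg z₂)),
      Subgroup.mem_prod.2 ⟨hodgeCircleSL_mem_hodgeGroup Φ₁ (Complex.arg z₁), hodgeCircleSL_mem_hodgeGroup Φ₂ (Complex.arg z₂)⟩,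
      rfl⟩
  have hr : (‖z₁‖ : ℝ) ≠ 0 := (norm_pos_iff.2 hz₁).ne'
  have hMeq : M = Matrix.GeneralLinearGroup.scalar (ι₁ ⊕ ι₂) (Units.mk0 ‖z₁‖ hr) *
      (Matrix.SpecialLinearGroup.toGL
        (blockDiag ι₁ ι₂ (hodgeCircleSL Φ₁ (Complex.arg z₁), hodgeCircleSL Φ₂ (Complex.arg z₂))) : GL (ι₁ ⊕ ι₂) ℝ) := by
    refine Units.ext ?_
    rw [hM, fromBlocks_hodgeS_eq_smul_of_norm_eq Φ₁ Φ₂ hnorm, coe_scalar_mul_toGL_blockDiag, Units.val_mk0,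
      coe_hodgeCircleSL, coe_hodgeCircleSL]
  rw [hMeq]
  exact scalar_mul_toGL_mem_mumfordTateGroup (prodPeriod Φ₁ Φ₂) (Units.mk0 ‖z₁‖ hr) hNmem

/-- **THE SPLIT BRANCH: `M ∈ MT(X₁ × X₂)(ℝ)` ⟺ `M = (h₁(z₁) 0; 0 h₂(z₂))` WITH `z₁ ≠ 0` AND `|z₁| = |z₂|`** (both
factors on the Hodge-circle locus, `Hom(X₁, X₂) = 0`) — Lombardo's «`𝔾_m · (M₁ × M₂)`, `M_i = {x x̄ = 1}`, rank 3» /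
Moonen's Exercise (5.6), CM × CM non-isogenous, for `E_{τ₁}^{g₁} × E_{τ₂}^{g₂}` up to isogeny, on real points.
[cite: Lombardo2019, §2.2 case 5 (arXiv:1610.09674 p. 4)] [cite: Moonen2004MT, §5 (5.6) Exercise with Hint and §4 Lemma 4.6]
[cite: CarlsonMullerStachPeters2017, §15.2 Problem 15.2.3 (a)] -/
theorem mem_mumfordTateGroup_prodPeriod_iff_of_coe_eq_range_of_homRat_eq_bot (hg₁ : 0 < finrank ℂ E₁)
    (hg₂ : 0 < finrank ℂ E₂) (h₁ : (hodgeGroup Φ₁ : Set (SpecialLinearGroup ι₁ ℝ)) = Set.range (hodgeCircleSL Φ₁))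
    (h₂ : (hodgeGroup Φ₂ : Set (SpecialLinearGroup ι₂ ℝ)) = Set.range (hodgeCircleSL Φ₂)) (h12 : homRat Φ₁ Φ₂ = ⊥)
    {M : GL (ι₁ ⊕ ι₂) ℝ} :
    M ∈ mumfordTateGroup (prodPeriod Φ₁ Φ₂) ↔ ∃ z₁ z₂ : ℂ, z₁ ≠ 0 ∧ ‖z₁‖ = ‖z₂‖ ∧
      (M : Matrix (ι₁ ⊕ ι₂) (ι₁ ⊕ ι₂) ℝ) = Matrix.fromBlocks (hodgeS Φ₁ z₁) 0 0 (hodgeS Φ₂ z₂) := by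
  constructor
  · intro hM
    obtain ⟨z₁, z₂, hz₁, -, hnorm, hM'⟩ :=
      exists_eq_fromBlocks_hodgeS_of_mem_mumfordTateGroup_prodPeriod Φ₁ Φ₂ hg₁ hg₂ h₁ h₂ hM
    exact ⟨z₁, z₂, hz₁, hnorm, hM'⟩
  · rintro ⟨z₁, z₂, hz₁, hnorm, hM⟩
    exact mem_mumfordTateGroup_prodPeriod_of_coe_eq_fromBlocks_hodgeS Φ₁ Φ₂ hg₁ hg₂ h₁ h₂ h12 hz₁ hnorm hM

/-- **THE FIBRE PRODUCT OVER THE MULTIPLIER: on the split branch `(A 0; 0 B) ∈ MT(X₁ × X₂)(ℝ)` ⟺ `A ∈ MT(X₁)(ℝ)`,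
`B ∈ MT(X₂)(ℝ)` AND `det(A)^{2g₂} = det(B)^{2g₁}`** — `MT(X₁ × X₂) = MT(X₁) ×_{𝔾_m} MT(X₂)`, the central `𝔾_m` counted once
(`det hᵢ(zᵢ) = |zᵢ|^{2gᵢ}`; Moonen (5.2): `M̃T ⊂ M̃T(X₁) ×_{𝔾_m} M̃T(X₂)` with equality here).
[cite: Moonen2004MT, §5 (5.2) and §4 Lemma 4.6] [cite: Moonen1999MTNotes, (1.13) Remark] [cite: CarlsonMullerStachPeters2017, §15.2 Problem 15.2.3 (a)] -/
theorem blockDiagGL_mem_mumfordTateGroup_prodPeriod_iff_of_coe_eq_range_of_homRat_eq_bot (hg₁ : 0 < finrank ℂ E₁)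
    (hg₂ : 0 < finrank ℂ E₂) (h₁ : (hodgeGroup Φ₁ : Set (SpecialLinearGroup ι₁ ℝ)) = Set.range (hodgeCircleSL Φ₁))
    (h₂ : (hodgeGroup Φ₂ : Set (SpecialLinearGroup ι₂ ℝ)) = Set.range (hodgeCircleSL Φ₂)) (h12 : homRat Φ₁ Φ₂ = ⊥)
    {A : GL ι₁ ℝ} {B : GL ι₂ ℝ} :
    blockDiagGL ι₁ ι₂ ℝ (A, B) ∈ mumfordTateGroup (prodPeriod Φ₁ Φ₂) ↔
      A ∈ mumfordTateGroup Φ₁ ∧ B ∈ mumfordTateGroup Φ₂ ∧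
        (A : Matrix ι₁ ι₁ ℝ).det ^ Fintype.card ι₂ = (B : Matrix ι₂ ι₂ ℝ).det ^ Fintype.card ι₁ := by
  haveI := nonempty_index_of_finrank_pos Φ₁ hg₁
  haveI := nonempty_index_of_finrank_pos Φ₂ hg₂
  constructor
  · intro h
    obtain ⟨A', hA', B', hB', hAB⟩ := exists_eq_blockDiagGL_of_mem_mumfordTateGroup_prod Φ₁ Φ₂ h
    obtain ⟨rfl, rfl⟩ := Prod.mk.inj (blockDiagGL_injective ι₁ ι₂ ℝ hAB)
    exact ⟨hA', hB', det_pow_eq_of_blockDiagGL_mem_mumfordTateGroup_prod Φ₁ Φ₂ h⟩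
  · rintro ⟨hA, hB, hdet⟩
    have hA' : A ∈ (mumfordTateGroup Φ₁ : Set (GL ι₁ ℝ)) := hA
    have hB' : B ∈ (mumfordTateGroup Φ₂ : Set (GL ι₂ ℝ)) := hB
    rw [coe_mumfordTateGroup_eq_range_hodgeSGL_of_coe_hodgeGroup_eq_range Φ₁ h₁, mem_range_hodgeSGL_iff] at hA'
    rw [coe_mumfordTateGroup_eq_range_hodgeSGL_of_coe_hodgeGroup_eq_range Φ₂ h₂, mem_range_hodgeSGL_iff] at hB'
    obtain ⟨z₁, hz₁, hAz⟩ := hA'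
    obtain ⟨z₂, -, hBz⟩ := hB'
    rw [hAz, hBz, det_hodgeS, det_hodgeS, ← pow_mul, ← pow_mul, mul_comm (Fintype.card ι₂)] at hdet
    have hnorm : ‖z₁‖ = ‖z₂‖ :=
      (pow_left_inj₀ (norm_nonneg z₁) (norm_nonneg z₂) (mul_ne_zero Fintype.card_ne_zero Fintype.card_ne_zero)).1 hdet
    exact mem_mumfordTateGroup_prodPeriod_of_coe_eq_fromBlocks_hodgeS Φ₁ Φ₂ hg₁ hg₂ h₁ h₂ h12 hz₁ hnorm
      (by rw [coe_blockDiagGL, hAz, hBz])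

/-- **`(1 0; 0 −1) = (h₁(1) 0; 0 h₂(−1)) ∈ MT(X₁ × X₂)(ℝ)` ON THE SPLIT BRANCH** (`|1| = |−1|`; compare `Hom ≠ 0`, where it
is the tree's witness of `MT(X₁ × X₂) ⊊ MT(X₁) ×_{𝔾_m} MT(X₂)`). [cite: Moonen2004MT, §5 (5.6) Exercise, Hint] [cite: Lombardo2019, §2.2 case 5] -/
theorem blockDiagGL_one_neg_one_mem_mumfordTateGroup_prodPeriod_of_homRat_eq_bot (hg₁ : 0 < finrank ℂ E₁)
    (hg₂ : 0 < finrank ℂ E₂) (h₁ : (hodgeGroup Φ₁ : Set (SpecialLinearGroup ι₁ ℝ)) = Set.range (hodgeCircleSL Φ₁))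
    (h₂ : (hodgeGroup Φ₂ : Set (SpecialLinearGroup ι₂ ℝ)) = Set.range (hodgeCircleSL Φ₂)) (h12 : homRat Φ₁ Φ₂ = ⊥) :
    blockDiagGL ι₁ ι₂ ℝ (1, -1) ∈ mumfordTateGroup (prodPeriod Φ₁ Φ₂) :=
  mem_mumfordTateGroup_prodPeriod_of_coe_eq_fromBlocks_hodgeS Φ₁ Φ₂ hg₁ hg₂ h₁ h₂ h12 (z₁ := 1) (z₂ := -1) one_ne_zero
    (by rw [norm_neg]) (by
      rw [coe_blockDiagGL, Units.val_one, Units.val_neg, Units.val_one, ← Complex.ofReal_one, hodgeS_ofReal, one_smul,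
        ← Complex.ofReal_neg, hodgeS_ofReal, neg_smul, one_smul])

/-- **ON THE SPLIT BRANCH `MT(X₁ × X₂)(ℝ) ∩ SL = Hg(X₁ × X₂)(ℝ)` EXACTLY**: an element of `SL(V₁ ⊕ V₂)(ℝ)` lies in
`Hg(X₁ × X₂)(ℝ)` iff it lies in `MT(X₁ × X₂)(ℝ)` (`det (h₁(z₁) 0; 0 h₂(z₂)) = |z₁|^{2g₁}|z₂|^{2g₂} = r^{2g} = 1` forces `r = 1`,
both blocks rotations; no finite-index defect on real points). [cite: Gordon1997, §2.3 Lemma (ii), (iii)]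
[cite: Lange2023AbelianVarietiesComplex, §7.2.1 Remark 7.2.2 (2)] -/
theorem mem_hodgeGroup_prodPeriod_iff_toGL_mem_mumfordTateGroup_of_homRat_eq_bot (hg₁ : 0 < finrank ℂ E₁)
    (hg₂ : 0 < finrank ℂ E₂) (h₁ : (hodgeGroup Φ₁ : Set (SpecialLinearGroup ι₁ ℝ)) = Set.range (hodgeCircleSL Φ₁))
    (h₂ : (hodgeGroup Φ₂ : Set (SpecialLinearGroup ι₂ ℝ)) = Set.range (hodgeCircleSL Φ₂)) (h12 : homRat Φ₁ Φ₂ = ⊥)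
    (N : SpecialLinearGroup (ι₁ ⊕ ι₂) ℝ) :
    N ∈ hodgeGroup (prodPeriod Φ₁ Φ₂) ↔ (Matrix.SpecialLinearGroup.toGL N : GL (ι₁ ⊕ ι₂) ℝ) ∈ mumfordTateGroup (prodPeriod Φ₁ Φ₂) := by
  haveI := nonempty_index_of_finrank_pos Φ₁ hg₁
  haveI := nonempty_index_of_finrank_pos Φ₂ hg₂
  refine ⟨toGL_mem_mumfordTateGroup _, fun hN ↦ ?_⟩
  obtain ⟨z₁, z₂, hz₁, -, hnorm, hN'⟩ :=
    exists_eq_fromBlocks_hodgeS_of_mem_mumfordTateGroup_prodPeriod Φ₁ Φ₂ hg₁ hg₂ h₁ h₂ hN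
  rw [Matrix.SpecialLinearGroup.coe_GL_coe_matrix] at hN'
  -- `det N = 1` forces `|z₁| = 1`
  have hdet : (N : Matrix (ι₁ ⊕ ι₂) (ι₁ ⊕ ι₂) ℝ).det = 1 := N.2
  rw [hN', Matrix.det_fromBlocks_zero₂₁, det_hodgeS, det_hodgeS, ← hnorm, ← pow_add] at hdet
  have hone : ‖z₁‖ = 1 :=
    (pow_eq_one_iff_of_nonneg (norm_nonneg z₁) (Nat.add_pos_left Fintype.card_pos _).ne').1 hdet
  -- so both blocks are rotations and `N ∈ Hg(X₁) × Hg(X₂) = Hg(X₁ × X₂)`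
  have hNeq : N = blockDiag ι₁ ι₂ (hodgeCircleSL Φ₁ (Complex.arg z₁), hodgeCircleSL Φ₂ (Complex.arg z₂)) := by
    refine Subtype.ext ?_
    rw [hN', fromBlocks_hodgeS_eq_smul_of_norm_eq Φ₁ Φ₂ hnorm, hone, one_smul, coe_blockDiag, coe_hodgeCircleSL,
      coe_hodgeCircleSL]
  rw [hNeq, hodgeGroup_prodPeriod_eq_map_blockDiag_of_coe_eq_range_of_homRat_eq_bot Φ₁ Φ₂ hg₁ hg₂ h₁ h₂ h12]
  exact Subgroup.mem_map.2 ⟨(hodgeCircleSL Φ₁ (Complex.arg z₁), hodgeCircleSL Φ₂ (Complex.arg z₂)),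
    Subgroup.mem_prod.2 ⟨hodgeCircleSL_mem_hodgeGroup Φ₁ (Complex.arg z₁), hodgeCircleSL_mem_hodgeGroup Φ₂ (Complex.arg z₂)⟩,
    rfl⟩

end Split

/-! ## §3 The dichotomy: `MT(X₁ × X₂)(ℝ) = h(ℂ^×)` ⟺ `Hom ≠ 0`; `(1, −1) ∈ MT(X₁ × X₂)` ⟺ `Hom = 0`; commutative either way -/

section Dichotomy

/-- **`MT(X₁ × X₂)(ℝ) = h(ℂ^×)` (THE DELIGNE TORUS, DIAGONAL) ⟺ `Hom(X₁, X₂) ≠ 0`** for two tori on the locus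
(g32-#2's `MT = h(ℂ^×)` ⟺ `Hg = h(S¹)` at `X₁ × X₂`, and g32-#1's `Hg(X₁ × X₂) = h(S¹)` ⟺ `Hom ≠ 0`) — Lombardo's case 6
«`𝔾_m · {(x, x) | x ∈ M}`» versus case 5. [cite: Lombardo2019, §2.2 cases 5 and 6] [cite: CarlsonMullerStachPeters2017, §15.2 Examples 15.2.4 (ii)]
[cite: Beauville2014MaximalPicard, §4 Lemma 1] -/
theorem coe_mumfordTateGroup_prodPeriod_eq_range_hodgeSGL_iff_homRat_ne_bot (hg₁ : 0 < finrank ℂ E₁)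
    (hg₂ : 0 < finrank ℂ E₂) (h₁ : (hodgeGroup Φ₁ : Set (SpecialLinearGroup ι₁ ℝ)) = Set.range (hodgeCircleSL Φ₁))
    (h₂ : (hodgeGroup Φ₂ : Set (SpecialLinearGroup ι₂ ℝ)) = Set.range (hodgeCircleSL Φ₂)) :
    (mumfordTateGroup (prodPeriod Φ₁ Φ₂) : Set (GL (ι₁ ⊕ ι₂) ℝ)) = Set.range (hodgeSGL (prodPeriod Φ₁ Φ₂)) ↔
      homRat Φ₁ Φ₂ ≠ ⊥ := by
  haveI := nonempty_index_of_finrank_pos Φ₁ hg₁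
  rw [coe_mumfordTateGroup_eq_range_hodgeSGL_iff_coe_hodgeGroup_eq_range,
    coe_hodgeGroup_prodPeriod_eq_range_iff_homRat_ne_bot Φ₁ Φ₂ hg₁ hg₂]
  exact ⟨fun h ↦ h.2.2, fun h ↦ ⟨h₁, h₂, h⟩⟩

/-- **`Hom ≠ 0`: `M ∈ MT(X₁ × X₂)(ℝ)` ⟺ `M = (h₁(z) 0; 0 h₂(z))` for ONE `z ≠ 0`** (the diagonal Deligne torus, rank 2).
[cite: Lombardo2019, §2.2 case 6 (arXiv:1610.09674 p. 4)] [cite: Moonen2004MT, §5 (5.6) Exercise, Hint] -/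
theorem mem_mumfordTateGroup_prodPeriod_iff_of_coe_eq_range_of_homRat_ne_bot (hg₁ : 0 < finrank ℂ E₁)
    (hg₂ : 0 < finrank ℂ E₂) (h₁ : (hodgeGroup Φ₁ : Set (SpecialLinearGroup ι₁ ℝ)) = Set.range (hodgeCircleSL Φ₁))
    (h₂ : (hodgeGroup Φ₂ : Set (SpecialLinearGroup ι₂ ℝ)) = Set.range (hodgeCircleSL Φ₂)) (h12 : homRat Φ₁ Φ₂ ≠ ⊥)
    {M : GL (ι₁ ⊕ ι₂) ℝ} :
    M ∈ mumfordTateGroup (prodPeriod Φ₁ Φ₂) ↔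
      ∃ z : ℂ, z ≠ 0 ∧ (M : Matrix (ι₁ ⊕ ι₂) (ι₁ ⊕ ι₂) ℝ) = Matrix.fromBlocks (hodgeS Φ₁ z) 0 0 (hodgeS Φ₂ z) := by
  haveI := nonempty_index_of_finrank_pos Φ₁ hg₁
  have hMT := (coe_mumfordTateGroup_prodPeriod_eq_range_hodgeSGL_iff_homRat_ne_bot Φ₁ Φ₂ hg₁ hg₂ h₁ h₂).2 h12
  rw [← SetLike.mem_coe, hMT, mem_range_hodgeSGL_iff]
  simp only [hodgeS_prodPeriod]

/-- **`(1 0; 0 −1) ∈ MT(X₁ × X₂)(ℝ)` ⟺ `Hom(X₁, X₂) = 0`** for two tori on the locus: on the split branch it is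
`(h₁(1), h₂(−1))` (§2); with a non-zero `B ∈ Hom_ℚ(X₁, X₂)` it would give `−B = B` (the tree's
`blockDiagGL_one_neg_one_not_mem_mumfordTateGroup_prod`). [cite: Moonen2004MT, §5 (5.6) Exercise, Hint («a non-zero Hodge class in `Hom(V₁, V₂)`»)]
[cite: Imai1976HodgeGroups, §3 Remarks (p. 370)] -/
theorem blockDiagGL_one_neg_one_mem_mumfordTateGroup_prodPeriod_iff_homRat_eq_bot (hg₁ : 0 < finrank ℂ E₁)
    (hg₂ : 0 < finrank ℂ E₂) (h₁ : (hodgeGroup Φ₁ : Set (SpecialLinearGroup ι₁ ℝ)) = Set.range (hodgeCircleSL Φ₁))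
    (h₂ : (hodgeGroup Φ₂ : Set (SpecialLinearGroup ι₂ ℝ)) = Set.range (hodgeCircleSL Φ₂)) :
    blockDiagGL ι₁ ι₂ ℝ (1, -1) ∈ mumfordTateGroup (prodPeriod Φ₁ Φ₂) ↔ homRat Φ₁ Φ₂ = ⊥ := by
  refine ⟨fun h ↦ ?_, blockDiagGL_one_neg_one_mem_mumfordTateGroup_prodPeriod_of_homRat_eq_bot Φ₁ Φ₂ hg₁ hg₂ h₁ h₂⟩
  by_contra hne
  obtain ⟨B, hB, hB0⟩ := Submodule.ne_bot_iff _ |>.1 hne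
  exact blockDiagGL_one_neg_one_not_mem_mumfordTateGroup_prod Φ₁ Φ₂ hB hB0 h

/-- **«ALMOST NEVER EQUAL»: `MT(X₁ × X₂)(ℝ) ⊊ MT(X₁)(ℝ) × MT(X₂)(ℝ)` on both branches** (`g₁, g₂ ≥ 1`; the tree's
`mumfordTateGroup_prod_lt` — `(2·1, 1)` violates the multiplier relation — recalled for the locus).
[cite: Moonen1999MTNotes, (1.13) Remark] [cite: CarlsonMullerStachPeters2017, §15.2 Problem 15.2.3 (a)] -/
theorem mumfordTateGroup_prodPeriod_lt_of_finrank_pos (hg₁ : 0 < finrank ℂ E₁) (hg₂ : 0 < finrank ℂ E₂) :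
    mumfordTateGroup (prodPeriod Φ₁ Φ₂) <
      ((mumfordTateGroup Φ₁).prod (mumfordTateGroup Φ₂)).map (blockDiagGL ι₁ ι₂ ℝ) := by
  haveI := nonempty_index_of_finrank_pos Φ₁ hg₁
  haveI := nonempty_index_of_finrank_pos Φ₂ hg₂
  exact mumfordTateGroup_prod_lt Φ₁ Φ₂

/-- **ON THE SPLIT BRANCH `MT(X₁ × X₂)(ℝ)` IS NOT THE DELIGNE TORUS**: `(h₁(1) 0; 0 h₂(−1))` is not of the form
`(h₁(z) 0; 0 h₂(z))` (`h₁` injective), although it lies in `MT(X₁ × X₂)(ℝ)`. [cite: Lombardo2019, §2.2 case 5 («rank 3»)]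
[cite: Moonen1999MTNotes, (1.13) Remark] -/
theorem coe_mumfordTateGroup_prodPeriod_ne_range_hodgeSGL_of_homRat_eq_bot (hg₁ : 0 < finrank ℂ E₁)
    (hg₂ : 0 < finrank ℂ E₂) (h₁ : (hodgeGroup Φ₁ : Set (SpecialLinearGroup ι₁ ℝ)) = Set.range (hodgeCircleSL Φ₁))
    (h₂ : (hodgeGroup Φ₂ : Set (SpecialLinearGroup ι₂ ℝ)) = Set.range (hodgeCircleSL Φ₂)) (h12 : homRat Φ₁ Φ₂ = ⊥) :
    (mumfordTateGroup (prodPeriod Φ₁ Φ₂) : Set (GL (ι₁ ⊕ ι₂) ℝ)) ≠ Set.range (hodgeSGL (prodPeriod Φ₁ Φ₂)) := fun h ↦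
  ((coe_mumfordTateGroup_prodPeriod_eq_range_hodgeSGL_iff_homRat_ne_bot Φ₁ Φ₂ hg₁ hg₂ h₁ h₂).1 h) h12

end Dichotomy

/-! ## §4 Two CM elliptic curves: `MT(E_i × E_{i√2})(ℝ) = {(h₁(z₁) 0; 0 h₂(z₂)) : |z₁| = |z₂| ≠ 0}` -/

section Elliptic

/-- `dim_ℂ ℂ = 1 > 0`. [folklore] -/
private theorem finrank_complex_self_pos' : 0 < finrank ℂ ℂ := by rw [Module.finrank_self]; exact one_pos

/-- **EXERCISE (5.6), CM × CM, DIFFERENT FIELDS: `MT(E_i × E_{i√2})(ℝ) = {(h₁(z₁) 0; 0 h₂(z₂)) : |z₁| = |z₂| ≠ 0}`** =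
`T_{ℚ(i)} ×_{Nm} T_{ℚ(√−2)}` on real points (`(K₁ ⊗ ℝ)^× ×_{|·|} (K₂ ⊗ ℝ)^×`). [cite: Moonen2004MT, §5 (5.6) Exercise]
[cite: Lombardo2019, §2.2 case 5] [cite: CarlsonMullerStachPeters2017, §15.2 Examples 15.2.4 (ii)] -/
theorem mem_mumfordTateGroup_prodPeriod_I_I_mul_sqrt_two_iff (hI : Complex.I.im ≠ 0) (h : (Complex.I * Real.sqrt 2).im ≠ 0)
    {M : GL (Fin 2 ⊕ Fin 2) ℝ} :
    M ∈ mumfordTateGroup (prodPeriod (ellipticPeriod hI) (ellipticPeriod h)) ↔ ∃ z₁ z₂ : ℂ, z₁ ≠ 0 ∧ ‖z₁‖ = ‖z₂‖ ∧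
      (M : Matrix (Fin 2 ⊕ Fin 2) (Fin 2 ⊕ Fin 2) ℝ) =
        Matrix.fromBlocks (hodgeS (ellipticPeriod hI) z₁) 0 0 (hodgeS (ellipticPeriod h) z₂) := by
  obtain ⟨h₁, h₂, hbot, -⟩ := coe_hodgeGroup_prodPeriod_I_I_mul_sqrt_two_ne_range hI h
  exact mem_mumfordTateGroup_prodPeriod_iff_of_coe_eq_range_of_homRat_eq_bot _ _ finrank_complex_self_pos'
    finrank_complex_self_pos' h₁ h₂ hbot

/-- … and `(1 0; 0 −1) ∈ MT(E_i × E_{i√2})(ℝ)` (while `(1 0; 0 −1) ∉ MT(E_i × E_i)(ℝ)`). [cite: Moonen2004MT, §5 (5.6) Exercise, Hint] -/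
theorem blockDiagGL_one_neg_one_mem_mumfordTateGroup_prodPeriod_I_I_mul_sqrt_two (hI : Complex.I.im ≠ 0)
    (h : (Complex.I * Real.sqrt 2).im ≠ 0) :
    blockDiagGL (Fin 2) (Fin 2) ℝ (1, -1) ∈ mumfordTateGroup (prodPeriod (ellipticPeriod hI) (ellipticPeriod h)) := by
  obtain ⟨h₁, h₂, hbot, -⟩ := coe_hodgeGroup_prodPeriod_I_I_mul_sqrt_two_ne_range hI h
  exact blockDiagGL_one_neg_one_mem_mumfordTateGroup_prodPeriod_of_homRat_eq_bot _ _ finrank_complex_self_pos'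
    finrank_complex_self_pos' h₁ h₂ hbot

end Elliptic

end ComplexTorus

end Literature.Geometry.Kaehler
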